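import Summits.QuantumFields.BalabanUV.T4Continuum.Support.NE7StrippedConstraintMap
import Summits.QuantumFields.BalabanUV.T4Continuum.Support.NE7AccumulatedFrameDictionary
import Summits.QuantumFields.BalabanUV.T4Continuum.Support.NE3SmoothRightInverseW
import Summits.QuantumFields.BalabanUV.T4Continuum.Support.NE3CovariantLineSumsTower
import Literature.MathematicalPhysics.QuantumFieldTheory.Balaban1983to89.B7BlockAvgLog
import HarnessLib

/-!
# NE7StrippedConstraintLinearisation — THE STRIPPED CONSTRAINT MAP IS DIFFERENTIABLE AT `0` WITH DIFFERENTIAL THE STRAIGHT TOWER: `DΨ(0)X = skewPR(res(QbarIter L (j+1) U♯ X̃))`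
# (lineage `b2b-balaban-t4-ne7-p1`, gen 119, file H7 = ROAD-G119 §5 S3, first half)

Cell `pub-balaban`, rung (B)+1 sub-cell t4, CRUX PROVER NE7 #1 (OWNER of row NE7), generation 119.
Over H6 ✓ `NE7StrippedConstraintMap` (`strippedConstraint L N j U♯ Φ = skewPR(log(V₀⁻¹·(U̿^{j+1}(Φ)·V₀)))`) and this lineage's gen-97 level dictionary ✓ `NE7AccumulatedFrameDictionary.level_dictionary`
(in the regime of [Balaban1985Averaging] Prop. 4 at the base `U♯`: `U̿^{j+1}(X) = expCfg(Ad_{V₀}ψ_X)`, `‖ψ_X‖ ≤ 2L^{j+1}b`, `‖ψ_X − QbarIter (j+1) U♯ X̃‖ ≤ 16C₁(L^{j+1}b)²` for `sup‖X̃‖ ≤ b`), the chart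
coordinate of the stripped configuration IS `ψ_X` bondwise (`log(V₀⁻¹·e^{Ad_{V₀}ψ}V₀) = log e^{ψ} = ψ`, ✓ `B7BlockAvgLog.mlog_exp`), so `‖Ψ(X) − skewPR(res(QbarIter X̃))‖ ≤ 16C₁L^{2(j+1)}‖X‖²` — a QUADRATIC
remainder, whence the Fréchet derivative at `0`.  The straight tower is packaged as a continuous linear map by row NE3's additivity∕homogeneity in the class (✓ `QbarIter_add`, ✓ `QbarIter_smul`).
WHAT ([folklore]; 1 def, 0 sorry; general `d`, `L ≥ 2`): `qbarIterCLM` (the CLM `X ↦ skewPR N (res (QbarIter L (j+1) U♯ X̃))` on `skewSub (L·tower L N j)`), `qbarIterCLM_apply`; `norm_chartDir_le`;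
`strippedCfg_eq_chart_of_dictionary` (bondwise `U̿·V₀ = V₀·e^{ψ}`); **`norm_strippedConstraint_sub_le`** (the quadratic remainder, in the Prop-4 regime at `U♯` with `b = ‖X‖`);
**`hasFDerivAt_strippedConstraint`**: `HasFDerivAt (strippedConstraint L N j U♯) (qbarIterCLM …) 0` under the background letters of the dictionary (`0 < α₀`, `C0·α₀ ≤ 1∕3`, `4α₀ ≤ c2′`,
`pdev U♯ < α₀·L^{-2(j+1)}`, ROOM `exp(3200(d+1)²(d+4)α₀) ≤ 3∕2`) and the class letters of `QbarIter_add` (`LevelSmall d L j x`, `SmallField U♯ x`).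
HONEST FRAMING (page 1): composition of landed kernel theorems; the background letters are HYPOTHESES (for the minimiser in `sfClass` they follow from `pdev U♯ ≤ ε·L^{-2(j+1)}` with `α₀ = 2ε`, successor);
`C²`-smoothness of `Ψ` (S2) is NOT here; nothing of Bałaban's asserted (Prop. 4, (127)–(133) context only); NOT (G′), NOT NE7 as a spine node; spine 0∕9; finite T⁴ rung (B)+1 — NOT infinite volume, NOT
mass gap, NOT BetaPertH, NOT Clay.
-/

set_option autoImplicit false

open scoped BigOperators Matrix Matrix.Norms.L2Operator Topology
open Filter Asymptotics

namespace Summit.QuantumFields.BalabanUV.T4Continuum.NE7StrippedConstraintLinearisation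

open Literature.MathematicalPhysics.QuantumFieldTheory.Balaban1983to89
open B7Prop1Explicit B7Prop2Explicit B7Prop3Flat MatrixLog
open B7Eq92Concrete (dbavgCovIter Rc Rc_apply expUnit_conj)
open B7Prop4GeneralLevels (logCovIter)
open B7BlockAvgLog (mlog_exp)
open T4AveragingDeficitWall (Ad IsUnitaryCfg SmallField)
open AveragingDeficitTorusChart (TDir chartDir redN skewP)
open AveragingDeficitChartCalculus (relLog)
open AveragingDeficitTwoLevelPrep (skewSub skewPR skewPF skewPF_apply)
open AveragingDeficitMultiLevelPrep (tower cavgIter LevelSmall tower_ne_zero)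
open AveragingDeficitMultiLevelBridge (cavgIter_eq_avgIter)
open NE3TangentCovariantTower (QbarIter)
open NE3CovariantLineSumsTower (QbarIter_add)
open NE3SmoothRightInverseW (QbarIter_smul)
open NE3.QbarDictionary (adField)
open NE3.PairLandauB8Avg (relPert)
open NE7AccumulatedFrameDictionary (level_dictionary)
open NE7TorusChartDecoding (norm_skewP_le)
open NE7StrippedConstraintMap (strippedCfg strippedConstraint)

noncomputable section

variable {d : ℕ} {n : Type} [Fintype n] [DecidableEq n]

/-- The periodic extension of a torus field is bounded by its (sup) norm. [folklore] -/
theorem norm_chartDir_le {M : ℕ} [NeZero M] (X : TDir d n M) (x : Site d) (κ : Fin d) :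
    ‖chartDir (ContinuousLinearMap.id ℝ (Matrix n n ℂ)) M X x κ‖ ≤ ‖X‖ := by
  show ‖X (redN M x) κ‖ ≤ ‖X‖
  exact (norm_le_pi_norm (X (redN M x)) κ).trans (norm_le_pi_norm X (redN M x))

section CLM

variable [Nonempty n] {L N : ℕ} [NeZero L] [NeZero N] (hL : 1 ≤ L) (j : ℕ) {Us : Site d → Fin d → (Matrix n n ℂ)ˣ} {x : ℝ}
  (hUu : IsUnitaryCfg Us) (hx : 0 ≤ x) (hs : LevelSmall d L j x) (hUx : SmallField Us x)

/-- **THE STRAIGHT TOWER AS A CONTINUOUS LINEAR MAP ON THE TORUS DIRECTIONS**: `X ↦ skewPR N (res (QbarIter L (j+1) U♯ X̃))`, `X̃ = chartDir id X` (additive and homogeneous by row NE3's class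
letters; continuous as a linear map of finite-dimensional spaces). [folklore] -/
def qbarIterCLM : ↥(skewSub d n (L * tower L N j)) →L[ℝ] ↥(skewSub d n N) :=
  LinearMap.toContinuousLinearMap
    { toFun := fun X => skewPR N (AveragingDeficitTorusChart.resDir N
        (QbarIter L (j + 1) Us (chartDir (ContinuousLinearMap.id ℝ (Matrix n n ℂ)) (L * tower L N j) (X : TDir d n (L * tower L N j)))))
      map_add' := fun X Y => by
        have hXY : chartDir (ContinuousLinearMap.id ℝ (Matrix n n ℂ)) (L * tower L N j) ((X + Y : ↥(skewSub d n (L * tower L N j))) : TDir d n (L * tower L N j))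
            = fun y μ => chartDir (ContinuousLinearMap.id ℝ (Matrix n n ℂ)) (L * tower L N j) (X : TDir d n (L * tower L N j)) y μ
              + chartDir (ContinuousLinearMap.id ℝ (Matrix n n ℂ)) (L * tower L N j) (Y : TDir d n (L * tower L N j)) y μ := by
          funext y μ; rfl
        rw [hXY, QbarIter_add hL j hUu hx hs hUx, ← map_add]
        rfl
      map_smul' := fun c X => by
        have hcX : chartDir (ContinuousLinearMap.id ℝ (Matrix n n ℂ)) (L * tower L N j) ((c • X : ↥(skewSub d n (L * tower L N j))) : TDir d n (L * tower L N j))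
            = c • chartDir (ContinuousLinearMap.id ℝ (Matrix n n ℂ)) (L * tower L N j) (X : TDir d n (L * tower L N j)) := by
          funext y μ; rfl
        rw [hcX, QbarIter_smul hL j hUu hx hs hUx, RingHom.id_apply, ← map_smul]
        rfl }

/-- Unfolding of `qbarIterCLM`. [folklore] -/
theorem qbarIterCLM_apply (X : ↥(skewSub d n (L * tower L N j))) :
    qbarIterCLM hL j hUu hx hs hUx X = skewPR N (AveragingDeficitTorusChart.resDir N
        (QbarIter L (j + 1) Us (chartDir (ContinuousLinearMap.id ℝ (Matrix n n ℂ)) (L * tower L N j) (X : TDir d n (L * tower L N j))))) := rfl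

end CLM

/-- Bondwise: `e^{V·ψ·V⁻¹}·V = V·e^{ψ}` for a unit `V`. [folklore] -/
theorem expUnit_Ad_mul (V : (Matrix n n ℂ)ˣ) (ψ : Matrix n n ℂ) : expUnit (Ad V ψ) * V = V * expUnit ψ := by
  have h : expUnit (Ad V ψ) = Rc V (expUnit ψ) := by
    unfold Ad; exact expUnit_conj V ψ
  rw [h, Rc_apply, inv_mul_cancel_right]

/-- **THE QUADRATIC REMAINDER OF THE STRIPPED CONSTRAINT** in the regime of [Balaban1985Averaging] Prop. 4 at the base `U♯` (hypotheses of ✓ `level_dictionary` with `k = j+1`, `b = ‖X‖`, and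
`2·L^{j+1}‖X‖ < log 2`): `‖Ψ(X) − skewPR(res(QbarIter L (j+1) U♯ X̃))‖ ≤ 16C₁·(L^{j+1}‖X‖)²`, `C₁ = 131072(d+1)²`. [folklore] -/
theorem norm_strippedConstraint_sub_le [Nonempty n] {L N : ℕ} [NeZero L] [NeZero N] (hL : 2 ≤ L) (j : ℕ)
    {Us : Site d → Fin d → (Matrix n n ℂ)ˣ} (hUu : IsUnitaryCfg Us) {α₀ b : ℝ} (hα : 0 < α₀) (hα3 : B7Prop2Explicit.C0 d * α₀ ≤ 1 / 3) (hα4 : 4 * α₀ ≤ B7Prop2Explicit.c2' d L)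
    (h52 : B7Prop2Explicit.pdev Us < α₀ * (((L : ℝ) ^ (j + 1))⁻¹) ^ 2) (X : ↥(skewSub d n (L * tower L N j))) (hXb : ‖X‖ ≤ b)
    (hsmall : Real.exp (4 * (800 * ((d : ℝ) + 1) ^ 2 * ((d : ℝ) + 4)) * α₀) * (1 + 8 * (131072 * ((d : ℝ) + 1) ^ 2) * ((L : ℝ) ^ (j + 1) * b)) ≤ 2)
    (hc₃ : 2 * ((L : ℝ) ^ (j + 1) * b) ≤ B7Prop3Flat.c3 d L) (hlog : 2 * ((L : ℝ) ^ (j + 1) * b) < Real.log 2) :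
    ‖((strippedConstraint L N j Us X : ↥(skewSub d n N)) : TDir d n N)
        - ((skewPR N (AveragingDeficitTorusChart.resDir N (QbarIter L (j + 1) Us
            (chartDir (ContinuousLinearMap.id ℝ (Matrix n n ℂ)) (L * tower L N j) (X : TDir d n (L * tower L N j))))) : ↥(skewSub d n N)) : TDir d n N)‖
      ≤ 16 * (131072 * ((d : ℝ) + 1) ^ 2) * ((L : ℝ) ^ (j + 1) * b) ^ 2 := by
  have hb : 0 ≤ b := (norm_nonneg _).trans hXb
  have hXb' : ∀ (y : Site d) (κ : Fin d), ‖(chartDir (ContinuousLinearMap.id ℝ (Matrix n n ℂ)) (L * tower L N j) (X : TDir d n (L * tower L N j))) y κ‖ ≤ b :=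
    fun y κ => (norm_chartDir_le (X : TDir d n (L * tower L N j)) y κ).trans hXb
  obtain ⟨-, hii, -, hiv, hv⟩ := level_dictionary (d := d) (n := n) hL (j + 1) hUu hα hα3 hα4 h52 hb hXb' hsmall hc₃ (j + 1) le_rfl
  -- the chart coordinate of the stripped configuration is the dictionary's level field `ψ`, bondwise on the top torus
  have hcoord : ∀ (r : Fin d → Fin N) (κ : Fin d),
      relLog N (cavgIter L (j + 1) Us) (strippedCfg L j Us (X : TDir d n (L * tower L N j))) r κ
        = Ad (avgIter L Us (j + 1) (boxVec N r) κ)⁻¹ (logCovIter L Us (adField Us (chartDir (ContinuousLinearMap.id ℝ (Matrix n n ℂ)) (L * tower L N j) (X : TDir d n (L * tower L N j)))) (j + 1) (boxVec N r) κ) := by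
    intro r κ
    have hcfg : strippedCfg L j Us (X : TDir d n (L * tower L N j)) (boxVec N r) κ
        = avgIter L Us (j + 1) (boxVec N r) κ * expUnit (Ad (avgIter L Us (j + 1) (boxVec N r) κ)⁻¹ (logCovIter L Us (adField Us (chartDir (ContinuousLinearMap.id ℝ (Matrix n n ℂ)) (L * tower L N j) (X : TDir d n (L * tower L N j)))) (j + 1) (boxVec N r) κ)) := by
      show dbavgCovIter L Us (relPert Us (chartDir (ContinuousLinearMap.id ℝ (Matrix n n ℂ)) (L * tower L N j) (X : TDir d n (L * tower L N j)))) (j + 1) (boxVec N r) κ * cavgIter L (j + 1) Us (boxVec N r) κ = _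
      rw [hii, cavgIter_eq_avgIter]
      exact expUnit_Ad_mul _ _
    have hn : ‖Ad (avgIter L Us (j + 1) (boxVec N r) κ)⁻¹ (logCovIter L Us (adField Us (chartDir (ContinuousLinearMap.id ℝ (Matrix n n ℂ)) (L * tower L N j) (X : TDir d n (L * tower L N j)))) (j + 1) (boxVec N r) κ)‖ < Real.log 2 :=
      (hiv (boxVec N r) κ).trans_lt hlog
    simp only [relLog, hcfg, Units.val_mul, ← mul_assoc, cavgIter_eq_avgIter, Units.inv_mul, one_mul, val_expUnit]
    exact mlog_exp hn
  -- pointwise bound, then the pi norm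
  have hpt : ∀ (r : Fin d → Fin N) (κ : Fin d),
      ‖(((strippedConstraint L N j Us X : ↥(skewSub d n N)) : TDir d n N)
          - ((skewPR N (AveragingDeficitTorusChart.resDir N (QbarIter L (j + 1) Us (chartDir (ContinuousLinearMap.id ℝ (Matrix n n ℂ)) (L * tower L N j) (X : TDir d n (L * tower L N j))))) : ↥(skewSub d n N)) : TDir d n N)) r κ‖
        ≤ 16 * (131072 * ((d : ℝ) + 1) ^ 2) * ((L : ℝ) ^ (j + 1) * b) ^ 2 := by
    intro r κ
    have e : (((strippedConstraint L N j Us X : ↥(skewSub d n N)) : TDir d n N)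
          - ((skewPR N (AveragingDeficitTorusChart.resDir N (QbarIter L (j + 1) Us (chartDir (ContinuousLinearMap.id ℝ (Matrix n n ℂ)) (L * tower L N j) (X : TDir d n (L * tower L N j))))) : ↥(skewSub d n N)) : TDir d n N)) r κ
        = skewP (Ad (avgIter L Us (j + 1) (boxVec N r) κ)⁻¹ (logCovIter L Us (adField Us (chartDir (ContinuousLinearMap.id ℝ (Matrix n n ℂ)) (L * tower L N j) (X : TDir d n (L * tower L N j)))) (j + 1) (boxVec N r) κ)
            - QbarIter L (j + 1) Us (chartDir (ContinuousLinearMap.id ℝ (Matrix n n ℂ)) (L * tower L N j) (X : TDir d n (L * tower L N j))) (boxVec N r) κ) := by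
      show (skewPF N (relLog N (cavgIter L (j + 1) Us) (strippedCfg L j Us (X : TDir d n (L * tower L N j))))) r κ
          - (skewPF N (AveragingDeficitTorusChart.resDir N (QbarIter L (j + 1) Us (chartDir (ContinuousLinearMap.id ℝ (Matrix n n ℂ)) (L * tower L N j) (X : TDir d n (L * tower L N j)))))) r κ = _
      rw [skewPF_apply, skewPF_apply, hcoord, map_sub]
      rfl
    rw [e]
    exact (norm_skewP_le _).trans (hv (boxVec N r) κ)
  refine (pi_norm_le_iff_of_nonneg (by positivity)).mpr fun r => (pi_norm_le_iff_of_nonneg (by positivity)).mpr fun κ => ?_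
  exact hpt r κ

/-- **THE STRIPPED CONSTRAINT IS FRÉCHET-DIFFERENTIABLE AT `0` WITH DIFFERENTIAL THE STRAIGHT TOWER** (see the module docstring). [folklore] -/
theorem hasFDerivAt_strippedConstraint [Nonempty n] {L N : ℕ} [NeZero L] [NeZero N] (hL : 2 ≤ L) (j : ℕ)
    {Us : Site d → Fin d → (Matrix n n ℂ)ˣ} {x : ℝ} (hUu : IsUnitaryCfg Us) (hx : 0 ≤ x) (hs : LevelSmall d L j x) (hUx : SmallField Us x)
    {α₀ : ℝ} (hα : 0 < α₀) (hα3 : B7Prop2Explicit.C0 d * α₀ ≤ 1 / 3) (hα4 : 4 * α₀ ≤ B7Prop2Explicit.c2' d L) (h52 : B7Prop2Explicit.pdev Us < α₀ * (((L : ℝ) ^ (j + 1))⁻¹) ^ 2)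
    (hroom : Real.exp (4 * (800 * ((d : ℝ) + 1) ^ 2 * ((d : ℝ) + 4)) * α₀) ≤ 3 / 2) :
    HasFDerivAt (strippedConstraint L N j Us) (qbarIterCLM (le_trans (by norm_num) hL) j hUu hx hs hUx) 0 := by
  haveI : NeZero (L * tower L N j) := ⟨Nat.mul_ne_zero (NeZero.ne L) (tower_ne_zero L N j)⟩
  have hL1 : 1 ≤ L := le_trans (by norm_num) hL
  set K : ℝ := 16 * (131072 * ((d : ℝ) + 1) ^ 2) * ((L : ℝ) ^ (j + 1)) ^ 2 with hK
  have hK0 : 0 ≤ K := by positivity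
  have hLp : 0 < (L : ℝ) ^ (j + 1) := by positivity
  -- a radius below which the three smallness conditions in `‖X‖` hold
  set ρ : ℝ := min (1 / (24 * (131072 * ((d : ℝ) + 1) ^ 2) * (L : ℝ) ^ (j + 1)))
      (min (B7Prop3Flat.c3 d L / (2 * (L : ℝ) ^ (j + 1))) (Real.log 2 / (4 * (L : ℝ) ^ (j + 1)))) with hρ
  have hc3 : 0 < B7Prop3Flat.c3 d L := by unfold B7Prop3Flat.c3; positivity
  have hlog2 : 0 < Real.log 2 := Real.log_pos (by norm_num)
  have hρ0 : 0 < ρ := by positivity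
  have hquad : ∀ X : ↥(skewSub d n (L * tower L N j)), ‖X‖ < ρ →
      ‖((strippedConstraint L N j Us X : ↥(skewSub d n N)) : TDir d n N)
          - ((qbarIterCLM hL1 j hUu hx hs hUx X : ↥(skewSub d n N)) : TDir d n N)‖ ≤ K * ‖X‖ ^ 2 := by
    intro X hX
    have hX0 : 0 ≤ ‖X‖ := norm_nonneg _
    have h1 : ‖X‖ ≤ 1 / (24 * (131072 * ((d : ℝ) + 1) ^ 2) * (L : ℝ) ^ (j + 1)) := hX.le.trans (min_le_left _ _)
    have h2 : ‖X‖ ≤ B7Prop3Flat.c3 d L / (2 * (L : ℝ) ^ (j + 1)) := hX.le.trans ((min_le_right _ _).trans (min_le_left _ _))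
    have h3 : ‖X‖ ≤ Real.log 2 / (4 * (L : ℝ) ^ (j + 1)) := hX.le.trans ((min_le_right _ _).trans (min_le_right _ _))
    have hsmall : Real.exp (4 * (800 * ((d : ℝ) + 1) ^ 2 * ((d : ℝ) + 4)) * α₀) * (1 + 8 * (131072 * ((d : ℝ) + 1) ^ 2) * ((L : ℝ) ^ (j + 1) * ‖X‖)) ≤ 2 := by
      have hC : 0 < 24 * (131072 * ((d : ℝ) + 1) ^ 2) * (L : ℝ) ^ (j + 1) := by positivity
      have ht : 8 * (131072 * ((d : ℝ) + 1) ^ 2) * ((L : ℝ) ^ (j + 1) * ‖X‖) ≤ 1 / 3 := by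
        have := (le_div_iff₀ hC).mp h1
        nlinarith
      have hE : 0 ≤ Real.exp (4 * (800 * ((d : ℝ) + 1) ^ 2 * ((d : ℝ) + 4)) * α₀) := (Real.exp_pos _).le
      calc Real.exp (4 * (800 * ((d : ℝ) + 1) ^ 2 * ((d : ℝ) + 4)) * α₀) * (1 + 8 * (131072 * ((d : ℝ) + 1) ^ 2) * ((L : ℝ) ^ (j + 1) * ‖X‖))
          ≤ (3 / 2) * (1 + 1 / 3) := mul_le_mul hroom (by linarith) (by positivity) (by norm_num)
        _ = 2 := by norm_num
    have hc₃ : 2 * ((L : ℝ) ^ (j + 1) * ‖X‖) ≤ B7Prop3Flat.c3 d L := by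
      have := (le_div_iff₀ (by positivity : (0 : ℝ) < 2 * (L : ℝ) ^ (j + 1))).mp h2
      nlinarith
    have hlog : 2 * ((L : ℝ) ^ (j + 1) * ‖X‖) < Real.log 2 := by
      have := (le_div_iff₀ (by positivity : (0 : ℝ) < 4 * (L : ℝ) ^ (j + 1))).mp h3
      nlinarith
    have h := norm_strippedConstraint_sub_le (N := N) hL j hUu hα hα3 hα4 h52 X le_rfl hsmall hc₃ hlog
    rw [qbarIterCLM_apply]
    calc _ ≤ 16 * (131072 * ((d : ℝ) + 1) ^ 2) * ((L : ℝ) ^ (j + 1) * ‖X‖) ^ 2 := h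
      _ = K * ‖X‖ ^ 2 := by rw [hK]; ring
  -- little-o
  rw [hasFDerivAt_iff_isLittleO_nhds_zero]
  refine Asymptotics.isLittleO_iff.mpr fun c hc => ?_
  have hev : ∀ᶠ X : ↥(skewSub d n (L * tower L N j)) in 𝓝 0, ‖X‖ < min ρ (c / (K + 1)) := by
    have h0 : (0 : ℝ) < min ρ (c / (K + 1)) := lt_min hρ0 (by positivity)
    exact (eventually_norm_sub_lt (0 : ↥(skewSub d n (L * tower L N j))) h0).mono fun X hX => by simpa using hX
  refine hev.mono fun X hX => ?_
  have hXρ : ‖X‖ < ρ := hX.trans_le (min_le_left _ _)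
  have hXc : ‖X‖ ≤ c / (K + 1) := (hX.trans_le (min_le_right _ _)).le
  have h0 : strippedConstraint L N j Us 0 = 0 := NE7StrippedConstraintMap.strippedConstraint_zero L N j Us
  rw [zero_add, h0, sub_zero]
  have hq := hquad X hXρ
  have hnorm : ‖strippedConstraint L N j Us X - qbarIterCLM hL1 j hUu hx hs hUx X‖
      = ‖((strippedConstraint L N j Us X : ↥(skewSub d n N)) : TDir d n N) - ((qbarIterCLM hL1 j hUu hx hs hUx X : ↥(skewSub d n N)) : TDir d n N)‖ := by
    rw [← Submodule.coe_sub, Submodule.coe_norm]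
  rw [hnorm]
  have hKX : K * ‖X‖ ≤ c := by
    have h1 : K * ‖X‖ ≤ K * (c / (K + 1)) := mul_le_mul_of_nonneg_left hXc hK0
    have h2 : K * (c / (K + 1)) ≤ c := by
      rw [mul_div_assoc']
      exact (div_le_iff₀ (by positivity)).mpr (by nlinarith)
    exact h1.trans h2
  calc _ ≤ K * ‖X‖ ^ 2 := hq
    _ = (K * ‖X‖) * ‖X‖ := by ring
    _ ≤ c * ‖X‖ := mul_le_mul_of_nonneg_right hKX (norm_nonneg _)

end

end Summit.QuantumFields.BalabanUV.T4Continuum.NE7StrippedConstraintLinearisation
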